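import Summits.BirchSwinnertonDyer.BirchSwinnertonDyer.Theorems.GenusKolyvaginAtTwoShaCardDvdPowAtTwoRTRestrictionKernelNontrivial
import Summits.BirchSwinnertonDyer.BirchSwinnertonDyer.Theorems.GenusKolyvaginAtTwoOffCutResidualAtTwoRLw2FlatRankDescent
import HarnessLib

/-!
# Route `GenusKolyvaginAtTwo`, LINE 26 «lw2_phantom_exclusion» of the residual crux `OffCutResidualAtTwoR` (stmt-BirchSwinnertonDyer-31767):
# the FLAT re-thread — part C: **the restriction-kernel frame package on the habitat, from `(NPh at 2N)` instead of an odd multiplicative prime**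

Seat `bsd-line-gk2-p5` g40 (WIDTH-5 attach, cell `bsd-f1-sign2`), `--supports stmt-BirchSwinnertonDyer-31767` (helper; closes nothing).
THEOREMS ONLY (no definition, no named fact, no `sorry`).  **BSD is NOT proved by any of this**; the residual crux is NOT closed by it.

WHY.  LINE 26 (`Cruxes/OffCutResidualAtTwoR/Lines/lw2_phantom_exclusion.lean`, stubs `stub_Q3flat` / `stub_Q4flat`) asks for the LANDED
exactness theorems Q3R_T (`…Theorems.equivariantKolyvaginExactAtTwoRT_proof`) and Q4_T″ (`…Theorems.kolyvaginExactAtTwoPosDiscT_proof`) with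
their binder quadruple `(v) (h2v : 2 ∉ v) (hNv : N ∈ v) (hmult : E multiplicative at v)` REPLACED by the hypothesis it was only ever used to
derive (critic #471 P1 census, card §7: 10 entry points, 36 pass-through signatures, 0 other uses of `v`):
`(NPh at 2N)(E, K)` := «for every `M ≥ 1`, a class of `H¹(K, E[2^M])` that dies on `Γ_(K(E[2^M]))` and is Kummer at every place over `2N`
is `0`» — VERBATIM the conclusion of `GenusExact.NonPhantomPow.nonPhantomAtTwo_of_hasMultiplicativeReductionAt` (with `N := N_E`).
Proofs below are the landed ones VERBATIM except that (i) the binder quadruple is gone and `hNPh` is inserted right after the two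
`¬ IsSquare` clauses (where `K` is in scope), (ii) at the entry points the local `(NPh_M)` is read off `hNPh` instead of the multiplicative
prime, (iii) callees are the `_flat` siblings.  Decl names = originals + `_flat`; namespaces unchanged.

WHAT (this part).  gk2-p1 g18's `…RTRestrictionKernelNontrivial` (frame package on the habitat: the `τ`-fixed half, a non-zero class in `ker(res : Ш(E^(d_K)/ℚ) → Ш(E/K))`,
and the `res`-preimage of anti-invariant classes), all four declarations; imports part A1 (`…Lw2FlatRankDescent`, `rank E(K) ≤ 1`).

References: [GrossLMS1991] §1, §5, §10; [Kolyvagin1990] Thm. A; [McCallumLMS1991] §1, §3, §5; [Kramer1981] Thm. 1; [LawsonWuthrich2016] §4, §8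
(the level-2 phantom class that supplies `(NPh at 2N)` off the cut — LINE 26 stubs `stub_KLW` / `stub_transport`, other seats).
-/

set_option autoImplicit false
-- the Theorems namespace of this sub repeats the summit name by design (D-0017 nested layout)
set_option linter.dupNamespace false

noncomputable section

universe u

/-! ## from `GenusKolyvaginAtTwoShaCardDvdPowAtTwoRTRestrictionKernelNontrivial` -/

open scoped Classical

namespace Summit.BirchSwinnertonDyer.BirchSwinnertonDyer.Theorems.GenusExact.PlusDescent

open Literature.NumberTheory.EllipticCurves Literature.NumberTheory.GaloisRepresentations WeierstrassCurve NumberField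
  IsDedekindDomain Field Literature.NumberTheory.EllipticCurves.ModularForms AddSubgroup
open Summit.BirchSwinnertonDyer.BirchSwinnertonDyer.Theses.GenusKolyvaginAtTwo (KolyvaginRelationAtTwo)
open Summit.BirchSwinnertonDyer.Rank1Residual

variable (W : WeierstrassCurve ℚ) [W.IsElliptic] [W.IsGloballyMinimal] [NeZero (W.conductorNorm ℤ)]
variable (K : Type) [Field K] [NumberField K]

/-- (LINE 26 FLAT form: the hypothesis `(NPh at 2N)(E, K)` replaces the odd multiplicative prime `v`.) **The frame package.**  On U_T's frame (rev-37 binders of `ShaCardDvdPowAtTwoRT`; only `hndiv` of the `M₀`-clause is used) with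
`W.rootNumber = 1` and `τ ∈ Aut(K/ℚ)` non-trivial, there are `Q₀ ∈ E(K)` and an ODD `m` with: `Q₀ ∉ 2E(K)`; `E(K)` has no `2`-torsion;
`τ(m • Q₀) + m • Q₀ = 0`; `τQ − Q ∈ 2E(K)` for EVERY `Q ∈ E(K)` (τ acts trivially on `E(K)/2E(K)`, a group of order `2^(rank E(K)) ≤ 2` by
`mordellWeilRank_baseChange_le_one_onHabitat_flat` and `natCard_quotient_range_zsmul`); and `m • Q₀ ≠ τQ − Q` for every `Q`.  (`2^(n₀) Q₀ = y_K`;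
`m` = order of the torsion point `τQ₀ + Q₀`, Gross 5.3 with `w = 1`.)
[cite: GrossLMS1991, §5 Prop. 5.3] [cite: Kramer1981, proof of Thm. 2] [cite: SilvermanAEC2009, X.§4] -/
theorem exists_framePackage_onHabitat_flat (hQ2 : KolyvaginRelationAtTwo) (hcm : ¬ W.HasCM)
    (hT : Odd W.tamagawaProduct) (hneg : W.Δ < 0)
    (hIQ : IsImaginaryQuadratic K) (hodd : Odd (NumberField.discr K))
    (h3 : NumberField.discr K ≠ -3) (hHe : SatisfiesHeegnerHypothesis (W.conductorNorm ℤ) K)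
    (hsq1 : ¬ IsSquare ((NumberField.discr K : ℚ) * -|W.Δ|)) (hsq2 : ¬ IsSquare ((NumberField.discr K : ℚ) * (-(2 * |W.Δ|))))
    (hNPh : ∀ (Mlev : ℕ), 1 ≤ Mlev → ∀ z : galH1Torsion (W.baseChange K) ((2 ^ Mlev : ℕ) : ℤ),
      (∀ ρ ∈ torsionFixing (W.baseChange K) ((2 ^ Mlev : ℕ) : ℤ), h1Eval (W.baseChange K) ((2 ^ Mlev : ℕ) : ℤ) z ρ = 0) →
      (∀ w : HeightOneSpectrum (𝓞 K), ((2 * W.conductorNorm ℤ : ℕ) : 𝓞 K) ∈ w.asIdeal →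
        z ∈ selmerLocalKer (W.baseChange K) (w.adicCompletion K) ((2 ^ Mlev : ℕ) : ℤ)) → z = 0)
    (hρ : ∀ n : ℕ, 0 < n → W.HasSurjectiveModNGaloisRep ((2 : ℤ) ^ n))
    (Dt : ModularParametrizationData W (W.conductorNorm ℤ)) (β : ℤ) (ι : K →+* ℂ) (d₁ : KolyvaginHeegnerData Dt β ι 1) (M₀ : ℕ)
    (hndiv : ¬ ∃ Q : (W.baseChange (ringClassField K ι 1)).toAffine.Point, ((2 ^ (M₀ + 1) : ℕ) : ℤ) • Q = d₁.derivedPoint)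
    (hw : W.rootNumber = 1) {τ : K ≃ₐ[ℚ] K} (hτ : τ ≠ 1) :
    ∃ (Q₀ : (W.baseChange K).toAffine.Point) (m : ℕ), Odd m ∧
      (∀ R : (W.baseChange K).toAffine.Point, (2 : ℤ) • R ≠ Q₀) ∧
      (∀ P : (W.baseChange K).toAffine.Point, (2 : ℤ) • P = 0 → P = 0) ∧
      Affine.Point.map (W' := W) (τ : K →ₐ[ℚ] K) (m • Q₀) + m • Q₀ = 0 ∧
      (∀ Q : (W.baseChange K).toAffine.Point, ∃ R : (W.baseChange K).toAffine.Point,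
        (2 : ℤ) • R = Affine.Point.map (W' := W) (τ : K →ₐ[ℚ] K) Q - Q) ∧
      (∀ Q : (W.baseChange K).toAffine.Point, Affine.Point.map (W' := W) (τ : K →ₐ[ℚ] K) Q - Q ≠ m • Q₀) ∧
      (∀ x y : (W.baseChange K).toAffine.Point, (¬ ∃ S : (W.baseChange K).toAffine.Point, (2 : ℤ) • S = x) →
        (¬ ∃ S : (W.baseChange K).toAffine.Point, (2 : ℤ) • S = y) → ∃ S : (W.baseChange K).toAffine.Point, (2 : ℤ) • S = x - y) := by
  haveI : Fact (Nat.Prime 2) := ⟨Nat.prime_two⟩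
  haveI hell : (W.baseChange K).IsElliptic := inferInstanceAs ((W.map (algebraMap ℚ K)).IsElliptic)
  have h2 : Module.finrank ℚ K = 2 := hIQ.1
  have hs2 : W.HasSurjectiveModNGaloisRep 2 := by simpa using hρ 1 one_pos
  have hττ : τ * τ = 1 := mul_self_eq_one_of_ne_one K hIQ.1 τ hτ
  set τm := WeierstrassCurve.Affine.Point.map (W' := W) (τ : K →ₐ[ℚ] K) with hτm
  have h2tors : ∀ P : (W.baseChange K).toAffine.Point, (2 : ℤ) • P = 0 → P = 0 := fun P hP ↦
    EigenClassesFinite.forall_zsmul_two_pow_baseChange_eq_zero_of_hasSurjectiveModNGaloisRep_two W K h2 hs2 1 P (by simpa using hP)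
  obtain ⟨Ph, hPh, hPhmap⟩ := AdditiveKoly.exists_isHeegnerPoint_map_eq_derivedPoint_one (W := W) (K := K) (Dt := Dt) (β := β)
    (ι := ι) hIQ hHe d₁
  have hP₀ : ∀ Q : (W.baseChange K).toAffine.Point, ((2 ^ (M₀ + 1) : ℕ) : ℤ) • Q ≠ Ph :=
    forall_two_pow_smul_ne_bottom_of_not_dvd_derivedPoint d₁ Ph hPhmap le_rfl hndiv
  obtain ⟨n₀, Q₀, -, hQ₀, hQ₀2⟩ : ∃ (n₀ : ℕ) (Q₀ : (W.baseChange K).toAffine.Point), n₀ ≤ M₀ ∧ ((2 ^ n₀ : ℕ) : ℤ) • Q₀ = Ph ∧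
      ∀ R : (W.baseChange K).toAffine.Point, (2 : ℤ) • R ≠ Q₀ := by
    let Pdiv : ℕ → Prop := fun n ↦ ∃ Q : (W.baseChange K).toAffine.Point, ((2 ^ n : ℕ) : ℤ) • Q = Ph
    have hP0 : Pdiv 0 := ⟨Ph, by rw [pow_zero, Nat.cast_one, one_zsmul]⟩
    obtain ⟨Q₀, hQ₀⟩ : Pdiv (Nat.findGreatest Pdiv M₀) := Nat.findGreatest_spec (Nat.zero_le M₀) hP0
    refine ⟨Nat.findGreatest Pdiv M₀, Q₀, Nat.findGreatest_le M₀, hQ₀, fun R hR ↦ ?_⟩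
    have hP : ((2 ^ (Nat.findGreatest Pdiv M₀ + 1) : ℕ) : ℤ) • R = Ph := by
      rw [pow_succ, Nat.cast_mul, mul_smul]
      have h2R : ((2 : ℕ) : ℤ) • R = Q₀ := by exact_mod_cast hR
      rw [h2R, hQ₀]
    by_cases hlt : Nat.findGreatest Pdiv M₀ + 1 ≤ M₀
    · exact Nat.findGreatest_is_greatest (Nat.lt_succ_self _) hlt ⟨R, hP⟩
    · have heq : Nat.findGreatest Pdiv M₀ = M₀ := by have := Nat.findGreatest_le (P := Pdiv) M₀; omega
      rw [heq] at hP
      exact hP₀ R hP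
  have hgross := X11b.KolyvaginBottom.isOfFinAddOrder_map_sub_neg_rootNumber_smul (W := W) hIQ hHe hPh τ hτ
  rw [hw] at hgross
  have ht : IsOfFinAddOrder (τm Q₀ + Q₀) := by
    refine isOfFinAddOrder_of_zsmul (n := ((2 ^ n₀ : ℕ) : ℤ)) (by positivity) ?_
    have heq : ((2 ^ n₀ : ℕ) : ℤ) • (τm Q₀ + Q₀) = τm Ph - (-(1 : ℤ)) • Ph := by
      rw [smul_add, ← map_zsmul, hQ₀, neg_smul, one_smul, sub_neg_eq_add]
    rw [heq]
    exact hgross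
  have hmodd : Odd (addOrderOf (τm Q₀ + Q₀)) := odd_addOrderOf_of_forall_two_smul_eq_zero (W.baseChange K) h2tors ht
  set m := addOrderOf (τm Q₀ + Q₀) with hm
  have hPanti : τm (m • Q₀) + m • Q₀ = 0 := by
    rw [map_nsmul, ← nsmul_add, hm, addOrderOf_nsmul_eq_zero]
  set N2 : AddSubgroup (W.baseChange K).toAffine.Point := (zsmulAddGroupHom (α := (W.baseChange K).toAffine.Point) ((2 : ℕ) : ℤ)).range
    with hN2
  have hmemN2 : ∀ x, x ∈ N2 ↔ ∃ y : (W.baseChange K).toAffine.Point, (2 : ℤ) • y = x := fun x ↦ by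
    simp only [hN2, AddMonoidHom.mem_range, zsmulAddGroupHom_apply, Nat.cast_ofNat]
  have hrk : (W.baseChange K).mordellWeilRank ≤ 1 :=
    mordellWeilRank_baseChange_le_one_onHabitat_flat hQ2 W hcm hT hneg K hIQ hodd h3 hHe hsq1 hsq2 hNPh hρ Dt β ι d₁ M₀ hndiv
  have htors1 : Nat.card ((W.baseChange K).toAffine.Point[((2 : ℕ) : ℤ)]) = 1 := by
    rw [Nat.card_eq_one_iff_unique]
    refine ⟨⟨fun x y ↦ Subtype.ext ?_⟩, ⟨0⟩⟩
    have hx : (2 : ℤ) • (x : (W.baseChange K).toAffine.Point) = 0 := by exact_mod_cast mem_torsionBy_iff.mp x.2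
    have hy : (2 : ℤ) • (y : (W.baseChange K).toAffine.Point) = 0 := by exact_mod_cast mem_torsionBy_iff.mp y.2
    rw [h2tors _ hx, h2tors _ hy]
  have hcardV : Nat.card ((W.baseChange K).toAffine.Point ⧸ N2) ≤ 2 := by
    rw [hN2, natCard_quotient_range_zsmul (W.baseChange K) (n := 2) two_ne_zero, htors1, mul_one]
    calc 2 ^ (W.baseChange K).mordellWeilRank ≤ 2 ^ 1 := Nat.pow_le_pow_right (by norm_num) hrk
      _ = 2 := by norm_num
  haveI : Finite ((W.baseChange K).toAffine.Point ⧸ N2) := by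
    apply Nat.finite_of_card_ne_zero
    rw [hN2, natCard_quotient_range_zsmul (W.baseChange K) (n := 2) two_ne_zero, htors1, mul_one]
    positivity
  have hV : ∀ x y : (W.baseChange K).toAffine.Point ⧸ N2, x ≠ 0 → y ≠ 0 → x = y := by
    intro x y hx hy
    by_contra hxy
    haveI : Fintype ((W.baseChange K).toAffine.Point ⧸ N2) := Fintype.ofFinite _
    have h3 : 2 < Fintype.card ((W.baseChange K).toAffine.Point ⧸ N2) :=
      (Fintype.two_lt_card_iff).mpr ⟨x, y, 0, hxy, hx, hy⟩
    rw [← Nat.card_eq_fintype_card] at h3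
    omega
  have hττx : ∀ x : K, τ (τ x) = x := fun x ↦ by
    change (τ * τ) x = x
    rw [hττ]
    rfl
  have hττm : ∀ Q : (W.baseChange K).toAffine.Point, τm (τm Q) = Q := fun Q ↦ by
    rcases Q with _ | ⟨x, y, h⟩
    · rfl
    · exact Affine.Point.some_eq_some_of_eq (hττx x) (hττx y)
  have hτN2 : ∀ Q : (W.baseChange K).toAffine.Point, τm Q - Q ∈ N2 := by
    intro Q
    rw [← QuotientAddGroup.eq_iff_sub_mem]
    by_cases hQ : (QuotientAddGroup.mk Q : (W.baseChange K).toAffine.Point ⧸ N2) = 0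
    · have hQmem : Q ∈ N2 := (QuotientAddGroup.eq_zero_iff Q).mp hQ
      obtain ⟨R, hR⟩ := (hmemN2 Q).mp hQmem
      have hτQ : τm Q ∈ N2 := (hmemN2 _).mpr ⟨τm R, by rw [← map_zsmul, hR]⟩
      rw [hQ, (QuotientAddGroup.eq_zero_iff _).mpr hτQ]
    · refine hV _ _ (fun hτQ ↦ hQ ?_) hQ
      obtain ⟨R, hR⟩ := (hmemN2 _).mp ((QuotientAddGroup.eq_zero_iff _).mp hτQ)
      exact (QuotientAddGroup.eq_zero_iff Q).mpr ((hmemN2 Q).mpr ⟨τm R, by rw [← map_zsmul, hR, hττm]⟩)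
  have hnp : ∀ Q : (W.baseChange K).toAffine.Point, τm Q - Q ≠ m • Q₀ := by
    intro Q hQ
    obtain ⟨R, hR⟩ := (hmemN2 _).mp (hQ ▸ hτN2 Q)
    obtain ⟨k, hk⟩ := hmodd
    refine hQ₀2 (R - (k : ℤ) • Q₀) ?_
    rw [smul_sub, hR, hk, smul_smul, ← natCast_zsmul Q₀ (2 * k + 1), ← sub_smul]
    push_cast
    rw [show (2 * (k : ℤ) + 1 - 2 * k) = 1 by ring, one_smul]
  have hV2 : ∀ x y : (W.baseChange K).toAffine.Point, (¬ ∃ S : (W.baseChange K).toAffine.Point, (2 : ℤ) • S = x) →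
      (¬ ∃ S : (W.baseChange K).toAffine.Point, (2 : ℤ) • S = y) → ∃ S : (W.baseChange K).toAffine.Point, (2 : ℤ) • S = x - y := by
    intro x y hx hy
    have hx' : (QuotientAddGroup.mk x : (W.baseChange K).toAffine.Point ⧸ N2) ≠ 0 := fun h ↦
      hx ((hmemN2 x).mp ((QuotientAddGroup.eq_zero_iff x).mp h))
    have hy' : (QuotientAddGroup.mk y : (W.baseChange K).toAffine.Point ⧸ N2) ≠ 0 := fun h ↦
      hy ((hmemN2 y).mp ((QuotientAddGroup.eq_zero_iff y).mp h))
    exact (hmemN2 _).mp ((QuotientAddGroup.eq_iff_sub_mem).mp (hV _ _ hx' hy'))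
  exact ⟨Q₀, m, hmodd, hQ₀2, h2tors, hPanti, fun Q ↦ (hmemN2 _).mp (hτN2 Q), hnp, hV2⟩

/-- (LINE 26 FLAT form: the hypothesis `(NPh at 2N)(E, K)` replaces the odd multiplicative prime `v`.) **τ-fixed points of `E(K)` are halvable by τ-fixed points, on U_T's frame** (with `W.rootNumber = 1`): if `τd = d` then `d = S + S` with
`τS = S`.  (`E(K)/2E(K) = {0, [Q₀]}`; the class `[Q₀]` is NOT τ-fixed-representable: `d = Q₀ + 2S`, `τd = d` would give
`m • Q₀ = τ(mS′) − mS′`, against the frame package; so `d ∈ 2E(K)`, `d = 2S`, and `2(τS − S) = 0` forces `τS = S`.)  This is the hypothesis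
`Ĥ⁰(C₂, E(K)) ⊇ E(ℚ)`-form needed by `exists_resBaseChange_eq_of_conjH1Points_eq_of_twoDivisible`. [cite: GrossLMS1991, §5 Prop. 5.3]
[cite: SerreGaloisCohomology1997, I §2.6 (b)] -/
theorem exists_fixed_half_onHabitat_flat (hQ2 : KolyvaginRelationAtTwo) (hcm : ¬ W.HasCM)
    (hT : Odd W.tamagawaProduct) (hneg : W.Δ < 0)
    (hIQ : IsImaginaryQuadratic K) (hodd : Odd (NumberField.discr K))
    (h3 : NumberField.discr K ≠ -3) (hHe : SatisfiesHeegnerHypothesis (W.conductorNorm ℤ) K)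
    (hsq1 : ¬ IsSquare ((NumberField.discr K : ℚ) * -|W.Δ|)) (hsq2 : ¬ IsSquare ((NumberField.discr K : ℚ) * (-(2 * |W.Δ|))))
    (hNPh : ∀ (Mlev : ℕ), 1 ≤ Mlev → ∀ z : galH1Torsion (W.baseChange K) ((2 ^ Mlev : ℕ) : ℤ),
      (∀ ρ ∈ torsionFixing (W.baseChange K) ((2 ^ Mlev : ℕ) : ℤ), h1Eval (W.baseChange K) ((2 ^ Mlev : ℕ) : ℤ) z ρ = 0) →
      (∀ w : HeightOneSpectrum (𝓞 K), ((2 * W.conductorNorm ℤ : ℕ) : 𝓞 K) ∈ w.asIdeal →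
        z ∈ selmerLocalKer (W.baseChange K) (w.adicCompletion K) ((2 ^ Mlev : ℕ) : ℤ)) → z = 0)
    (hρ : ∀ n : ℕ, 0 < n → W.HasSurjectiveModNGaloisRep ((2 : ℤ) ^ n))
    (Dt : ModularParametrizationData W (W.conductorNorm ℤ)) (β : ℤ) (ι : K →+* ℂ) (d₁ : KolyvaginHeegnerData Dt β ι 1) (M₀ : ℕ)
    (hndiv : ¬ ∃ Q : (W.baseChange (ringClassField K ι 1)).toAffine.Point, ((2 ^ (M₀ + 1) : ℕ) : ℤ) • Q = d₁.derivedPoint)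
    (hw : W.rootNumber = 1) {τ : K ≃ₐ[ℚ] K} (hτ : τ ≠ 1) (d : (W.baseChange K).toAffine.Point)
    (hd : Affine.Point.map (W' := W) (τ : K →ₐ[ℚ] K) d = d) :
    ∃ S : (W.baseChange K).toAffine.Point, Affine.Point.map (W' := W) (τ : K →ₐ[ℚ] K) S = S ∧ d = S + S := by
  obtain ⟨Q₀, m, -, hQ₀2, h2tors, hPanti, -, hnp, hV2⟩ := exists_framePackage_onHabitat_flat W K hQ2 hcm hT hneg hIQ hodd h3
    hHe hsq1 hsq2 hNPh hρ Dt β ι d₁ M₀ hndiv hw hτ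
  set τm := WeierstrassCurve.Affine.Point.map (W' := W) (τ : K →ₐ[ℚ] K) with hτm
  by_cases hdN : ∃ S : (W.baseChange K).toAffine.Point, (2 : ℤ) • S = d
  · -- `d = 2S`, and `2 (τS − S) = τd − d = 0` forces `τS = S`
    obtain ⟨S, hS⟩ := hdN
    refine ⟨S, ?_, by rw [← two_zsmul, hS]⟩
    have h0 : (2 : ℤ) • (τm S - S) = 0 := by rw [smul_sub, ← map_zsmul, hS, hd, sub_self]
    exact sub_eq_zero.mp (h2tors _ h0)
  · -- `d ∉ 2E(K)`: then `d − Q₀ = 2S`, and `τd = d` would make `m • Q₀ = τ(mS) − mS`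
    exfalso
    obtain ⟨S, hS⟩ := hV2 d Q₀ hdN (fun ⟨S, hS⟩ ↦ hQ₀2 S hS)
    refine hnp (m • S) (sub_eq_zero.mp (h2tors _ ?_))
    have hPanti' : m • τm Q₀ = -(m • Q₀) := by
      rw [← map_nsmul]
      exact eq_neg_of_add_eq_zero_left hPanti
    have h2S : (2 : ℤ) • τm S = d - τm Q₀ := by rw [← map_zsmul, hS, map_sub, hd]
    rw [smul_sub, smul_sub, map_nsmul, smul_comm (2 : ℤ) m (τm S), h2S, smul_comm (2 : ℤ) m S, hS, smul_sub, smul_sub,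
      hPanti', two_zsmul]
    abel

/-- (LINE 26 FLAT form: the hypothesis `(NPh at 2N)(E, K)` replaces the odd multiplicative prime `v`.) **The Kramer class of the generator is non-zero on U_T's frame** (with `W.rootNumber = 1`): `ker(resBaseChange W K) ≠ 0`
(§2 applied to `P = m • Q₀` of the frame package). [cite: Kramer1981, proof of Thm. 2] [cite: GrossLMS1991, §5 Prop. 5.3] -/
theorem exists_ne_zero_resBaseChange_eq_zero_onHabitat_flat (hQ2 : KolyvaginRelationAtTwo) (hcm : ¬ W.HasCM)
    (hT : Odd W.tamagawaProduct) (hneg : W.Δ < 0)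
    (hIQ : IsImaginaryQuadratic K) (hodd : Odd (NumberField.discr K))
    (h3 : NumberField.discr K ≠ -3) (hHe : SatisfiesHeegnerHypothesis (W.conductorNorm ℤ) K)
    (hsq1 : ¬ IsSquare ((NumberField.discr K : ℚ) * -|W.Δ|)) (hsq2 : ¬ IsSquare ((NumberField.discr K : ℚ) * (-(2 * |W.Δ|))))
    (hNPh : ∀ (Mlev : ℕ), 1 ≤ Mlev → ∀ z : galH1Torsion (W.baseChange K) ((2 ^ Mlev : ℕ) : ℤ),
      (∀ ρ ∈ torsionFixing (W.baseChange K) ((2 ^ Mlev : ℕ) : ℤ), h1Eval (W.baseChange K) ((2 ^ Mlev : ℕ) : ℤ) z ρ = 0) →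
      (∀ w : HeightOneSpectrum (𝓞 K), ((2 * W.conductorNorm ℤ : ℕ) : 𝓞 K) ∈ w.asIdeal →
        z ∈ selmerLocalKer (W.baseChange K) (w.adicCompletion K) ((2 ^ Mlev : ℕ) : ℤ)) → z = 0)
    (hρ : ∀ n : ℕ, 0 < n → W.HasSurjectiveModNGaloisRep ((2 : ℤ) ^ n))
    (Dt : ModularParametrizationData W (W.conductorNorm ℤ)) (β : ℤ) (ι : K →+* ℂ) (d₁ : KolyvaginHeegnerData Dt β ι 1) (M₀ : ℕ)
    (hndiv : ¬ ∃ Q : (W.baseChange (ringClassField K ι 1)).toAffine.Point, ((2 ^ (M₀ + 1) : ℕ) : ℤ) • Q = d₁.derivedPoint)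
    (hw : W.rootNumber = 1) :
    ∃ η : W.galH1, η ≠ 0 ∧ resBaseChange W K η = 0 := by
  obtain ⟨τ, hτ, -⟩ := Literature.NumberTheory.EllipticCurves.exists_conj_of_isImaginaryQuadratic (K := K) hIQ
  obtain ⟨Q₀, m, -, -, -, hPanti, -, hnp, -⟩ := exists_framePackage_onHabitat_flat W K hQ2 hcm hT hneg hIQ hodd h3 hHe hsq1 hsq2 hNPh hρ
    Dt β ι d₁ M₀ hndiv hw hτ
  exact exists_ne_zero_resBaseChange_eq_zero_of_point K W hIQ.1 hτ (m • Q₀) hPanti hnp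

/-- (LINE 26 FLAT form: the hypothesis `(NPh at 2N)(E, K)` replaces the odd multiplicative prime `v`.) **INVARIANT CLASSES ARE RESTRICTIONS ON U_T's FRAME** (with `W.rootNumber = 1`): for the non-trivial `σ ∈ Aut(K/ℚ)` and its chosen lift
`τ = liftAut σ`, every `s ∈ H¹(K, E_K)` with `τ_* s = s` is `res b` for some `b ∈ H¹(ℚ, E)` — `exists_resBaseChange_eq_of_conjH1Points_eq_of_twoDivisible`
fed with §3's halving of σ-fixed points (the transgression obstruction `E(ℚ)/N E(K)` vanishes).  Consequently every τ-fixed class of `Ш(E/K)[2^∞]`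
has a τ-INVARIANT Selmer lift (the ν-bit of LINE 19's SANDWICH′, memo §6c). [cite: SerreGaloisCohomology1997, I §2.6 (b)] [cite: GrossLMS1991, §5 (5.1)–(5.3)] -/
theorem exists_resBaseChange_eq_of_conjH1Points_eq_onHabitat_flat (hQ2 : KolyvaginRelationAtTwo) (hcm : ¬ W.HasCM)
    (hT : Odd W.tamagawaProduct) (hneg : W.Δ < 0)
    (hIQ : IsImaginaryQuadratic K) (hodd : Odd (NumberField.discr K))
    (h3 : NumberField.discr K ≠ -3) (hHe : SatisfiesHeegnerHypothesis (W.conductorNorm ℤ) K)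
    (hsq1 : ¬ IsSquare ((NumberField.discr K : ℚ) * -|W.Δ|)) (hsq2 : ¬ IsSquare ((NumberField.discr K : ℚ) * (-(2 * |W.Δ|))))
    (hNPh : ∀ (Mlev : ℕ), 1 ≤ Mlev → ∀ z : galH1Torsion (W.baseChange K) ((2 ^ Mlev : ℕ) : ℤ),
      (∀ ρ ∈ torsionFixing (W.baseChange K) ((2 ^ Mlev : ℕ) : ℤ), h1Eval (W.baseChange K) ((2 ^ Mlev : ℕ) : ℤ) z ρ = 0) →
      (∀ w : HeightOneSpectrum (𝓞 K), ((2 * W.conductorNorm ℤ : ℕ) : 𝓞 K) ∈ w.asIdeal →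
        z ∈ selmerLocalKer (W.baseChange K) (w.adicCompletion K) ((2 ^ Mlev : ℕ) : ℤ)) → z = 0)
    (hρ : ∀ n : ℕ, 0 < n → W.HasSurjectiveModNGaloisRep ((2 : ℤ) ^ n))
    (Dt : ModularParametrizationData W (W.conductorNorm ℤ)) (β : ℤ) (ι : K →+* ℂ) (d₁ : KolyvaginHeegnerData Dt β ι 1) (M₀ : ℕ)
    (hndiv : ¬ ∃ Q : (W.baseChange (ringClassField K ι 1)).toAffine.Point, ((2 ^ (M₀ + 1) : ℕ) : ℤ) • Q = d₁.derivedPoint)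
    (hw : W.rootNumber = 1) {σ : K ≃ₐ[ℚ] K} (hσ1 : σ ≠ 1)
    {s : (W.baseChange K).galH1} (hs : (isLiftOfAut_liftAut σ).conjH1Points W s = s) :
    ∃ b : W.galH1, resBaseChange W K b = s := by
  have h2 : Module.finrank ℚ K = 2 := hIQ.1
  haveI : Algebra.IsQuadraticExtension ℚ K := ⟨h2⟩
  haveI : IsGalois ℚ K := inferInstance
  haveI hNn : (galRange (K := ℚ) K).Normal := normal_galRange K h2 hσ1
  have hc := xor_galRange K h2 hσ1
  have hτ : IsLiftOfAut σ (liftAut σ) := isLiftOfAut_liftAut σ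
  refine exists_resBaseChange_eq_of_conjH1Points_eq_of_twoDivisible K W h2 hσ1 (fun P hP ↦ ?_) hs
  have hfix : ∀ g : Field.absoluteGaloisGroup K,
      g • geomPointsEquivBaseChange K W P = geomPointsEquivBaseChange K W P := fun g ↦ by
    rw [← geomPointsEquivBaseChange_smul', Subgroup.smul_def, hP]
  obtain ⟨d, hd⟩ := exists_toGeomPoints_eq_of_forall_smul_eq (W.baseChange K) hfix
  have hσd : Affine.Point.map (W' := W) (σ : K →ₐ[ℚ] K) d = d := by
    apply toGeomPoints_injective (W.baseChange K)
    rw [← hτ.pointsMap_toGeomPoints, hd, ← geomPointsEquivBaseChange_conj, hP]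
  obtain ⟨S, hS, hdS⟩ := exists_fixed_half_onHabitat_flat W K hQ2 hcm hT hneg hIQ hodd h3 hHe hsq1 hsq2 hNPh hρ Dt β ι d₁ M₀ hndiv
    hw hσ1 d hσd
  refine ⟨(geomPointsEquivBaseChange K W).symm (toGeomPoints (W.baseChange K) S), fun g ↦ ?_, ?_⟩
  · -- fixed by `N = galRange K` and by `c = liftToAbsGal σ`, hence by `G = N ⊔ N c`
    have hN' : ∀ n : galRange (K := ℚ) K,
        (n : Field.absoluteGaloisGroup ℚ) • (geomPointsEquivBaseChange K W).symm (toGeomPoints (W.baseChange K) S) =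
          (geomPointsEquivBaseChange K W).symm (toGeomPoints (W.baseChange K) S) := fun n ↦ by
      rw [← Subgroup.smul_def, ← geomPointsEquivBaseChange_symm_smul, smul_toGeomPoints]
    have hc' : liftToAbsGal (K := ℚ) K σ • (geomPointsEquivBaseChange K W).symm (toGeomPoints (W.baseChange K) S) =
        (geomPointsEquivBaseChange K W).symm (toGeomPoints (W.baseChange K) S) := by
      apply (geomPointsEquivBaseChange K W).injective
      rw [geomPointsEquivBaseChange_conj, AddEquiv.apply_symm_apply, hτ.pointsMap_toGeomPoints, hS]
    rcases exists_eq_or_eq_mul hc g with ⟨n, rfl⟩ | ⟨n, rfl⟩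
    · exact hN' n
    · rw [mul_smul, hc', hN' n]
  · apply (geomPointsEquivBaseChange K W).injective
    rw [map_add, AddEquiv.apply_symm_apply, ← hd, hdS, map_add]

end Summit.BirchSwinnertonDyer.BirchSwinnertonDyer.Theorems.GenusExact.PlusDescent

end
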